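import Literature.NumberTheory.Automorphic.QuadraticBaseChangeFrobCompatibleOfLocalGlobalProofs
import Literature.NumberTheory.Automorphic.HilbertModularLocalGlobalProofs
import Literature.NumberTheory.Automorphic.LocalComponentBJGenericProofs
import HarnessLib

/-!
# `Langlands1980_quadraticBaseChange_frobCompatible` from local–global compatibility (the tree's
# fact, VERBATIM) and ONE local theorem of Jacquet–Langlands: the `L`-factor transfer

Topic `Literature/NumberTheory/Automorphic`; proof file (theorems only: no definition, no named
fact, no instance) for the named fact
`Literature.NumberTheory.Automorphic.Langlands1980_quadraticBaseChange_frobCompatible`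
(`QuadraticBaseChangeFrobCompatible`), next to `…OfLocalGlobalProofs`.

`…OfLocalGlobalProofs` derived the fact from the accepted named fact
`galoisRep_GL2_totallyReal_localGlobal` (Carayol–Taylor–Blasius–Rogawski–Skinner local–global
compatibility at every finite place, `WD(r|_{Γ_{K_v}})^{F-ss} ≅ rec_v(π_v)`) STRENGTHENED by the
unramified clause of ITS OWN local Langlands data `llc v` ("`rec_v(π_v)` unramified with `N = 0`
⇒ `π_v` spherical"), plus lang.S27 and three Arthur–Clozel base-change facts.  That clause is not a
theorem about an abstract `LocalLanglandsDatum` (the six clauses of `IsLocalLanglandsGL` do not pin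
`rec` on non-generic classes).  This file removes it: the local components of cuspidal Borel–Jacquet
data are GENERIC (`CuspidalAutomorphicRepData.exists_isGeneric_of_hasLocalComponentAt`,
`LocalComponentBJGenericProofs`), so clause (iii-L) `lFactor_pairs` of the fact's own datum
(Harris–Taylor 2001, Thm. A (v); JPSS 1983, Thm. 2.7) applies to the pair `(π_v, 1)` and says that
the Euler factor `P₀ = det(1 - TΦ | (ker N)^{I})` of `rec_v(π_v) ⊗ rec_v(1)` IS the JPSS
`L`-polynomial of the pair; at a place where `r` is unramified, `rec_v(π_v) = WD(r|Γ_{K_v})^{F-ss}`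
is unramified with `N = 0` (`HilbertModularLocalGlobalProofs`), so `P₀` has degree `2`
(`natDegree_eulerFactor_tprod_eq_two`).  What is left is purely local and automorphic, free of any
local Langlands correspondence and of every `ℓ`-adic object:

  (JL)  *an irreducible smooth generic representation of `GL₂(F)` whose standard `L`-factor
        `L(s, π × 1)` has degree `2` is spherical* —
        Jacquet–Langlands 1970, Props. 3.5–3.6 with Thm. 2.18; Gelbart 1975, Thm. 6.15 (the table
        `L(s, π(μ₁, μ₂)) = L(s, μ₁) L(s, μ₂)`, `L(s, σ(μ₁, μ₂)) = L(s, μ₁)`, `L(s, π) = 1` for `π`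
        supercuspidal, `L(s, μ) ≠ 1` iff `μ` unramified, (6.34)–(6.35)) and Thm. 4.23 (an
        infinite-dimensional `π` is class `1` iff `π = π(μ₁, μ₂)` with `μ₁, μ₂` unramified and
        `π` not special);

not yet a theorem (or a named fact) of the tree, whose local theory does not compute
`HasRSLFactor` for any ramified representation; it is the hypothesis `hJL` below (stated for all
non-archimedean local fields `F : Type` of characteristic zero, all `ψ` and all invariant measures
`ν`, and for irreducible SMOOTH `π` — the printed statements assume `π` admissible, which is
automatic for irreducible smooth representations of `GL₂(F)`: Jacquet 1975, Bernstein 1974).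

* `natDegree_eulerFactor_of_inertiaInvariantsKerN_eq_top`, `inertiaInvariantsKerN_tprod_eq_top`,
  `natDegree_eulerFactor_tprod_eq_two` — Weil–Deligne linear algebra (Tate 1979, (4.1.6)).
* `hasRSLFactor_of_recGL_unramified` — **the transfer**: for a local Langlands datum `d` of `F`,
  a `ψ`-generic irreducible smooth `π_v` of `GL₂(F)` with `d.recGL 2 ⟦π_v⟧ = ⟦W⟧`, `W.N = 0`,
  `W.ρ` unramified, and every invariant measure `ν` on `GL₁(F) ⧸ U₁`: `L(s, π_v × 1) = 1/P₀(q^{-s})`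
  with `deg P₀ = 2` (`HasRSLFactor … P₀ ∧ P₀.natDegree = 2`).
* `isUnramifiedAt_of_isGaloisCompatibleAt_of_localGlobal_of_lFactor` — Carayol's ramification
  clause (C) from `galoisRep_GL2_totallyReal_localGlobal` VERBATIM and (JL) (the proof of
  `…OfLocalGlobalProofs` with the unramified clause replaced by genericity + transfer + (JL);
  Borel–Jacquet dictionary `isUnramifiedAt_of_hasLocalComponentAt_of_mem_fixedPoints`,
  `glInt_adicCompletion_eq`).
* `Langlands1980_quadraticBaseChange_frobCompatible_of_localGlobal_of_lFactor` — **the fact**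
  from `galoisRep_GL2_totallyReal_localGlobal`, (JL), lang.S27 (`exists_galoisRep_of_regularAlgebraic`),
  `ArthurClozel1989_strongLifting_archimedean`, `baseChange_cyclic_cuspidal`,
  `ArthurClozel1989_strongLifting_unramified` (via `…_of_carayol`, `…AuxFieldProofs`).

## References

* R. P. Langlands, *Base change for GL(2)*, Ann. of Math. Stud. 96 (1980), §2. [LanglandsBaseChange1980]
* H. Jacquet, R. P. Langlands, *Automorphic forms on GL(2)*, LNM 114 (1970), Thm. 2.18, Props. 3.5, 3.6.
* S. Gelbart, *Automorphic forms on adele groups*, Ann. of Math. Stud. 83 (1975), Thm. 4.23, Thm. 6.15,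
  (6.34)–(6.35). [Gelbart1975]
* M. Harris, R. Taylor, Ann. of Math. Stud. 151 (2001), Thm. A. [HarrisTaylorAMS2001]
* H. Jacquet, I. I. Piatetski-Shapiro, J. Shalika, Amer. J. Math. 105 (1983), Thm. 2.7. [JacquetPiatetskiShapiroShalika1983]
* J. Tate, *Number theoretic background*, Corvallis 1979, (4.1.6). [TateCorvallis1979]
* C. Skinner, Doc. Math. 14 (2009) 241–258, (1) p. 242. [Skinner2009]
* H. Carayol, Ann. Sci. ÉNS 19 (1986) 409–468, Thm. (A). [CarayolASENS1986]
-/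

noncomputable section

open scoped MatrixGroups Matrix NumberField TensorProduct
open NumberField IsDedekindDomain Field Filter Polynomial MeasureTheory

namespace Literature.NumberTheory.Automorphic

open Literature.NumberTheory.GaloisRepresentations

/-! ### Weil–Deligne linear algebra: the Euler factor of an unramified `N = 0` representation -/

section WD

variable {F : Type} [Field F] [ValuativeRel F] [TopologicalSpace F] [IsNonarchimedeanLocalField F]
variable {C : Type*} [Field C] [CharZero C] {V : Type*} [AddCommGroup V] [Module C V]
  {V' : Type*} [AddCommGroup V'] [Module C V']

/-- **`deg det(1 - TΦ | (ker N)^I) = dim V` when `(ker N)^I = V`**: the Euler factor is the reversed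
characteristic polynomial of the INVERTIBLE operator `ρ(Φ)` on `(ker N)^{I_F}`, whose characteristic
polynomial has non-zero constant term `± det ρ(Φ)`, so reversing does not drop the degree.
Tate, Corvallis 1979, (4.1.6). [cite: TateCorvallis1979, (4.1.6)] -/
theorem natDegree_eulerFactor_of_inertiaInvariantsKerN_eq_top [FiniteDimensional C V]
    (r : WeilDeligneRep F C V) (hn : absInertia_normal F) (hex : exists_isFrobPow (F := F))
    (htop : r.inertiaInvariantsKerN = ⊤) :
    (r.eulerFactor hn hex).natDegree = Module.finrank C V := by
  classical
  unfold WeilDeligneRep.eulerFactor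
  set b := Module.finBasis C r.inertiaInvariantsKerN with hb
  set e := r.restrictInertiaInvariantsKerN hn (WeilDeligneRep.geomFrob F hex) with he
  set M := LinearMap.toMatrix b b e with hM
  -- `ρ(Φ)|` is invertible, with inverse `ρ(Φ⁻¹)|`
  have hunit : IsUnit e := by
    refine ⟨⟨e, r.restrictInertiaInvariantsKerN hn (WeilDeligneRep.geomFrob F hex)⁻¹, ?_, ?_⟩, rfl⟩
    · refine LinearMap.ext fun v => Subtype.ext ?_
      rw [Module.End.mul_apply, he, WeilDeligneRep.coe_restrictInertiaInvariantsKerN_apply,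
        WeilDeligneRep.coe_restrictInertiaInvariantsKerN_apply, ← Module.End.mul_apply, ← map_mul,
        mul_inv_cancel, map_one, Module.End.one_apply, Module.End.one_apply]
    · refine LinearMap.ext fun v => Subtype.ext ?_
      rw [Module.End.mul_apply, he, WeilDeligneRep.coe_restrictInertiaInvariantsKerN_apply,
        WeilDeligneRep.coe_restrictInertiaInvariantsKerN_apply, ← Module.End.mul_apply, ← map_mul,
        inv_mul_cancel, map_one, Module.End.one_apply, Module.End.one_apply]
  have hdet : M.det ≠ 0 := by
    rw [hM, LinearMap.det_toMatrix]
    exact (hunit.map LinearMap.det).ne_zero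
  have h0 : M.charpoly.coeff 0 ≠ 0 := by
    intro h
    apply hdet
    rw [Matrix.det_eq_sign_charpoly_coeff, h, mul_zero]
  have htr : M.charpoly.natTrailingDegree = 0 :=
    Polynomial.natTrailingDegree_eq_zero_of_constantCoeff_ne_zero h0
  have hdeg := Polynomial.natDegree_eq_reverse_natDegree_add_natTrailingDegree M.charpoly
  rw [htr, add_zero, Matrix.charpoly_natDegree_eq_dim, Fintype.card_fin] at hdeg
  rw [← Matrix.reverse_charpoly, ← hdeg, htop, finrank_top]

/-- **`(ker N)^{I_F}` of `A ⊗ B` is everything when both factors have `N = 0` and trivial inertia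
action** (`N_{A⊗B} = N_A ⊗ 1 + 1 ⊗ N_B`, `(A ⊗ B)(u) = A(u) ⊗ B(u)`). Deligne, Antwerp II (1973),
(8.1.2), §8.12. [folklore] -/
theorem inertiaInvariantsKerN_tprod_eq_top (A : WeilDeligneRep F C V) (B : WeilDeligneRep F C V')
    (hAN : ∀ x, A.N x = 0) (hAρ : ∀ u ∈ WeilGroup.inertia F, ∀ x, A.ρ u x = x)
    (hBN : ∀ x, B.N x = 0) (hBρ : ∀ u ∈ WeilGroup.inertia F, ∀ x, B.ρ u x = x) :
    (A.tprod B).inertiaInvariantsKerN = ⊤ := by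
  rw [eq_top_iff]
  rintro z -
  rw [(A.tprod B).mem_inertiaInvariantsKerN_iff]
  refine ⟨?_, fun u hu => ?_⟩
  · induction z using TensorProduct.induction_on with
    | zero => rw [map_zero]
    | tmul a b =>
        rw [WeilDeligneRep.tprod_N, LinearMap.add_apply, TensorProduct.map_tmul, TensorProduct.map_tmul,
          hAN, hBN, TensorProduct.zero_tmul, TensorProduct.tmul_zero, add_zero]
    | add x y hx hy => rw [map_add, hx, hy, add_zero]
  · induction z using TensorProduct.induction_on with
    | zero => rw [map_zero]
    | tmul a b => rw [WeilDeligneRep.tprod_ρ_apply, TensorProduct.map_tmul, hAρ u hu, hBρ u hu]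
    | add x y hx hy => rw [map_add, hx, hy]

/-- **The Euler factor of `A ⊗ B` has degree `2`** for `A` two-dimensional and `B` one-dimensional,
both with `N = 0` and trivial inertia action: `deg det(1 - TΦ | A ⊗ B) = dim (A ⊗ B) = 2 · 1`.
Tate, Corvallis 1979, (4.1.6). [cite: TateCorvallis1979, (4.1.6)] -/
theorem natDegree_eulerFactor_tprod_eq_two (A : WeilDeligneRep F ℂ (Fin 2 → ℂ))
    (B : WeilDeligneRep F ℂ (Fin 1 → ℂ)) (hn : absInertia_normal F) (hex : exists_isFrobPow (F := F))
    (hAN : ∀ x, A.N x = 0) (hAρ : ∀ u ∈ WeilGroup.inertia F, ∀ x, A.ρ u x = x)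
    (hBN : ∀ x, B.N x = 0) (hBρ : ∀ u ∈ WeilGroup.inertia F, ∀ x, B.ρ u x = x) :
    ((A.tprod B).eulerFactor hn hex).natDegree = 2 := by
  rw [natDegree_eulerFactor_of_inertiaInvariantsKerN_eq_top _ hn hex
      (inertiaInvariantsKerN_tprod_eq_top A B hAN hAρ hBN hBρ),
    Module.finrank_tensorProduct, Module.finrank_fin_fun, Module.finrank_fin_fun]

end WD

/-! ### The transfer: `L(s, π_v × 1)` has degree `2` at a place with unramified parameter -/

section Transfer

variable {F : Type} [Field F] [ValuativeRel F] [TopologicalSpace F] [IsNonarchimedeanLocalField F]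

/-- **`L`-factor transfer through clause (iii-L) of a local Langlands datum.** Let `d` be a local
Langlands datum of `F`, `π_v` an irreducible smooth representation of `GL₂(F)`, generic for the
non-trivial continuous `ψ`, whose parameter `d.recGL 2 ⟦π_v⟧` is the class of a Frobenius-semisimple
`W` with `W.N = 0` and `W.ρ` unramified.  Then for every `GL₁(F)`-invariant Borel measure `ν` on
`GL₁(F) ⧸ U₁`, finite on compacts and positive on opens, the JPSS `L`-polynomial of the pair
`(π_v, 1)` (`1` the trivial representation of `GL₁(F)` on `ℂ`) is
`P₀ = det(1 - TΦ | (ker N)^{I})` of `(d.recGL 2 ⟦π_v⟧).out ⊗ (d.recGL 1 ⟦1⟧).out`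
(`lFactor_pairs`: Harris–Taylor 2001, Thm. A (v); JPSS 1983, Thm. 2.7 (i)–(ii)), and `P₀` has degree
`2`: `(d.recGL 2 ⟦π_v⟧).out ≅ W` is unramified with `N = 0` (`Quotient.exact`), `(d.recGL 1 ⟦1⟧).out`
is `(1 ∘ artin, N = 0)` by clause (ii) `gl_one` (Harris–Taylor 2001, Thm. A (ii)), and
`natDegree_eulerFactor_tprod_eq_two`.  So `L(s, π_v × 1) = L(s, π_v)` has degree `2` in `q^{-s}`.
[cite: HarrisTaylorAMS2001, Thm. A (ii), (v)] [cite: JacquetPiatetskiShapiroShalika1983, Thm. 2.7 (i)–(ii)]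
[cite: TateCorvallis1979, (4.1.6)] -/
theorem hasRSLFactor_of_recGL_unramified (d : LocalLanglandsDatum F)
    (πv : SmoothIrrep (GL (Fin 2) F)) (W : WeilDeligneRep F ℂ (Fin 2 → ℂ)) (hW : W.IsFrobSemisimple)
    (hq : d.recGL 2 (IrrClass.mk πv) = Quotient.mk (frobSemisimpleWDSetoid F 2) ⟨W, hW⟩)
    (hN : W.N = 0) (hur : WeilGroup.IsUnramifiedRep W.ρ)
    (ψ : AddChar F Circle) (hψ : ψ.IsContinuousNontrivial) (hgen : IsGeneric πv.ρ ψ)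
    [MeasurableSpace (GL (Fin 1) F ⧸ upperUnitriangular (Fin 1) F)]
    [BorelSpace (GL (Fin 1) F ⧸ upperUnitriangular (Fin 1) F)]
    (ν : Measure (GL (Fin 1) F ⧸ upperUnitriangular (Fin 1) F))
    [SMulInvariantMeasure (GL (Fin 1) F) (GL (Fin 1) F ⧸ upperUnitriangular (Fin 1) F) ν]
    [IsFiniteMeasureOnCompacts ν] [ν.IsOpenPosMeasure] :
    ∃ P : ℂ[X], HasRSLFactor Nat.one_lt_two πv.ρ (Representation.trivial ℂ (GL (Fin 1) F) ℂ) ψ ν P ∧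
      P.natDegree = 2 := by
  classical
  -- the trivial irreducible smooth representation `1 ∘ det` of `GL₁(F)` on `ℂ`, generic for `ψ⁻¹`
  let π' : SmoothIrrep (GL (Fin 1) F) :=
    { V := ℂ
      ρ := Representation.trivial ℂ (GL (Fin 1) F) ℂ
      isIrreducible := isIrreducible_of_finrank_eq_one' _ (Module.finrank_self ℂ)
      isSmooth := fun v => by
        have h : ((Representation.trivial ℂ (GL (Fin 1) F) ℂ).stabilizerSubgroup v :
            Set (GL (Fin 1) F)) = Set.univ := by
          ext x
          simp [Representation.mem_stabilizerSubgroup]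
        rw [Representation.IsSmoothVector, h]
        exact isOpen_univ }
  have hgen' : IsGeneric π'.ρ ψ⁻¹ := by
    refine (isGeneric_iff _ _).2 ⟨LinearMap.id, (mem_whittakerFunctionals_iff _).2 fun u v => ?_,
      fun h => one_ne_zero (LinearMap.congr_fun h (1 : ℂ))⟩
    have hs : superdiagSum u = 0 := by
      rw [superdiagSum_def]
      refine Finset.sum_eq_zero fun i _ => ?_
      have hi := i.isLt
      simp
    rw [whittakerCharFun_apply, hs, AddChar.map_zero_eq_one, Circle.coe_one, one_mul]
    rfl
  -- (iii-L) at `P₀ :=` the Euler factor itself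
  set A₀ := (d.recGL 2 (IrrClass.mk πv)).out.1 with hA₀
  set B₀ := (d.recGL 1 (IrrClass.mk π')).out.1 with hB₀
  set P₀ : ℂ[X] := (A₀.tprod B₀).eulerFactor d.hn d.hex with hP₀
  have hRS₀ : HasRSLFactor Nat.one_lt_two πv.ρ π'.ρ ψ ν P₀ :=
    (d.isLocalLanglands.lFactor_pairs Nat.one_pos Nat.one_lt_two πv π' ψ hψ hgen hgen' ν P₀).mpr hP₀
  refine ⟨P₀, hRS₀, ?_⟩
  -- (ii): `B₀ ≅ (1 ∘ artin, N = 0)`: `N = 0`, trivial on inertia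
  have hgl : B₀.IsEquivalent (WeilDeligneRep.ofQuasiChar d.hns d.artin 1) :=
    d.isLocalLanglands.gl_one 1 π' fun x v => by simp [π']
  obtain ⟨e⟩ := hgl
  set φ : (Fin 1 → ℂ) ≃ₗ[ℂ] ℂ := e.toRepEquiv.toLinearEquiv with hφ
  have hφρ : ∀ (u : WeilGroup F) (x : Fin 1 → ℂ),
      φ (B₀.ρ u x) = (WeilDeligneRep.ofQuasiChar d.hns d.artin 1).ρ u (φ x) := fun u x => by
    rw [hφ, Representation.Equiv.toLinearEquiv_apply, Representation.Equiv.toLinearEquiv_apply]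
    exact Representation.IntertwiningMap.isIntertwining _ _ e.toRepEquiv.toIntertwiningMap u x
  have hφN : ∀ x : Fin 1 → ℂ, φ (B₀.N x) = (WeilDeligneRep.ofQuasiChar d.hns d.artin 1).N (φ x) :=
    fun x => LinearMap.congr_fun e.comm_N x
  have hBρ : ∀ u ∈ WeilGroup.inertia F, ∀ x, B₀.ρ u x = x := by
    intro u _ x
    apply φ.injective
    rw [hφρ, WeilDeligneRep.ofQuasiChar_ρ_apply]
    simp
  have hBN : ∀ x, B₀.N x = 0 := by
    intro x
    apply φ.injective
    rw [hφN, WeilDeligneRep.ofQuasiChar_N, LinearMap.zero_apply, map_zero]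
  -- `A₀ ≅ W`: `N = 0`, trivial on inertia
  have hWA : W.IsEquivalent A₀ := Quotient.exact (hq.symm.trans (Quotient.out_eq _).symm)
  obtain ⟨e'⟩ := hWA
  set φ' : (Fin 2 → ℂ) ≃ₗ[ℂ] (Fin 2 → ℂ) := e'.symm.toRepEquiv.toLinearEquiv with hφ'
  have hφ'ρ : ∀ (u : WeilGroup F) (x : Fin 2 → ℂ), φ' (A₀.ρ u x) = W.ρ u (φ' x) := fun u x => by
    rw [hφ', Representation.Equiv.toLinearEquiv_apply, Representation.Equiv.toLinearEquiv_apply]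
    exact Representation.IntertwiningMap.isIntertwining _ _ e'.symm.toRepEquiv.toIntertwiningMap u x
  have hφ'N : ∀ x : Fin 2 → ℂ, φ' (A₀.N x) = W.N (φ' x) := fun x => LinearMap.congr_fun e'.symm.comm_N x
  have hAρ : ∀ u ∈ WeilGroup.inertia F, ∀ x, A₀.ρ u x = x := by
    intro u hu x
    apply φ'.injective
    rw [hφ'ρ, hur u hu, Module.End.one_apply]
  have hAN : ∀ x, A₀.N x = 0 := by
    intro x
    apply φ'.injective
    rw [hφ'N, hN, LinearMap.zero_apply, map_zero]
  exact natDegree_eulerFactor_tprod_eq_two A₀ B₀ d.hn d.hex hAN hAρ hBN hBρ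

end Transfer

/-! ### (C) from local–global compatibility and (JL); the fact -/

section LocalGlobal

/- The hypothesis `hJL` — (JL) of the module docstring: an irreducible smooth `ψ`-generic
representation of `GL₂(F)` (`F` a non-archimedean local field of characteristic zero, `ψ`
non-trivial continuous) whose JPSS `L`-polynomial against the trivial representation of `GL₁(F)`
has degree `2` for every invariant measure `ν` on `GL₁(F) ⧸ U₁` is spherical (has a non-zero
`GL₂(𝒪_F)`-fixed vector, `glInt 2 F`).  Jacquet–Langlands 1970, Props. 3.5–3.6, Thm. 2.18;
Gelbart 1975, Thm. 6.15 and Thm. 4.23 (irreducible smooth representations of `GL₂(F)` being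
admissible: Jacquet 1975, Bernstein 1974).  Not a theorem of the tree; see the module docstring. -/
variable
  (hJL : ∀ (F : Type) [Field F] [ValuativeRel F] [TopologicalSpace F] [IsNonarchimedeanLocalField F]
    [CharZero F] (πv : SmoothIrrep (GL (Fin 2) F)) (ψ : AddChar F Circle), ψ.IsContinuousNontrivial →
    IsGeneric πv.ρ ψ →
    (∀ [MeasurableSpace (GL (Fin 1) F ⧸ upperUnitriangular (Fin 1) F)]
      [BorelSpace (GL (Fin 1) F ⧸ upperUnitriangular (Fin 1) F)]
      (ν : Measure (GL (Fin 1) F ⧸ upperUnitriangular (Fin 1) F))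
      [SMulInvariantMeasure (GL (Fin 1) F) (GL (Fin 1) F ⧸ upperUnitriangular (Fin 1) F) ν]
      [IsFiniteMeasureOnCompacts ν] [ν.IsOpenPosMeasure],
      ∃ P : ℂ[X], HasRSLFactor Nat.one_lt_two πv.ρ (Representation.trivial ℂ (GL (Fin 1) F) ℂ) ψ ν P ∧
        P.natDegree = 2) →
    ∃ x : πv.V, x ≠ 0 ∧ x ∈ πv.ρ.fixedPoints (glInt 2 F))

include hJL in
/-- **Carayol's ramification clause (C) from local–global compatibility and (JL).**  `K` totally
real, `π` a regular algebraic cuspidal representation of `GL₂(𝔸_K)`, `ℓ` prime, `ι : ℚ̄_ℓ ≃ ℂ`,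
`r : Γ_K → GL₂(ℚ̄_ℓ)` continuous irreducible and compatible with `π` (`C`-normalisation) at every
`v ∤ ℓ` where `π` is unramified; then at every finite `w ∤ ℓ` where `r` is unramified, `π` is
unramified.  Proof: as `isUnramifiedAt_of_isGaloisCompatibleAt_of_localGlobalUnramified`
(inverse half twist `π₁ = π ⊗ |det|^{-1/2}`, `L`-algebraic regular; a.e. `L`-compatibility;
`galoisRep_GL2_totallyReal_localGlobal.exists_llc_recGL_unramified` at `w`: `rec_w(π₁,w) = ⟦r'⟧`
with `r'.N = 0`, `r'.ρ` unramified), then: `π₁,w` is generic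
(`CuspidalAutomorphicRepData.exists_isGeneric_of_hasLocalComponentAt`), `L(s, π₁,w × 1)` has
degree `2` (`hasRSLFactor_of_recGL_unramified`), so `π₁,w` is spherical by (JL), so `π₁` is
unramified at `w` (`isUnramifiedAt_of_hasLocalComponentAt_of_mem_fixedPoints`,
`glInt_adicCompletion_eq`), so `π` is (`isUnramifiedAt_iff_of_twist`).
[cite: CarayolASENS1986, Thm. (A) (pp. 410–411)] [cite: Skinner2009, (1) p. 242]
[cite: HarrisTaylorAMS2001, Thm. A (ii), (v)] -/
theorem isUnramifiedAt_of_isGaloisCompatibleAt_of_localGlobal_of_lFactor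
    (hLG : galoisRep_GL2_totallyReal_localGlobal)
    {K : Type} [Field K] [NumberField K] (hcpt : isCompact_glFiniteIntegralLevel 2 K)
    (hK : IsTotallyReal K) (π : CuspidalAutomorphicRepData 2 K hcpt) (hreg : π.1.IsRegularAlgebraic)
    (ℓ : ℕ) [Fact ℓ.Prime] (ι : PadicAlgCl ℓ ≃+* ℂ) (r : FramedGaloisRep K (PadicAlgCl ℓ) 2)
    (hirr : r.toGaloisRep.IsIrreducible)
    (hcomp : ∀ v : HeightOneSpectrum (𝓞 K), ((ℓ : ℕ) : 𝓞 K) ∉ v.asIdeal →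
      IsGaloisCompatibleAt π.1 ι r v)
    (w : HeightOneSpectrum (𝓞 K)) (hw : ((ℓ : ℕ) : 𝓞 K) ∉ w.asIdeal) (hur : r.IsUnramifiedAt w) :
    π.1.IsUnramifiedAt w := by
  obtain ⟨T, hT, hC, hTreg⟩ := hreg
  -- the inverse half twist `π₁ = π ⊗ |det|^{-1/2}`: `L`-algebraic with a regular infinity type
  obtain ⟨χ, π₁, hχ, hW, hW', hT₁⟩ := π.exists_twist_hasInfinityType (-(((2 : ℝ) - 1) / 2)) hT
  have e : (((-(((2 : ℝ) - 1) / 2) : ℝ)) : ℂ) = -((((2 : ℕ) : ℂ) - 1) / 2) := by push_cast; ring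
  have hL₁ : π₁.1.IsLAlgebraic :=
    ⟨_, hT₁, InfinityType.isLAlgebraic_twist_of_isCAlgebraic hC e⟩
  have hreg₁ : ∃ T' : InfinityType K 2, π₁.1.HasInfinityType T' ∧ T'.IsRegular :=
    ⟨_, hT₁, hTreg.twist _⟩
  -- every-unramified-place `C`-compatibility with `π` is a.e. `L`-compatibility with `π₁`
  have hae : SatakeFrobCompatibleAE ι π₁.1 r := by
    have h1 : ∀ᶠ v : HeightOneSpectrum (𝓞 K) in cofinite, π.1.IsUnramifiedAt v :=
      π.1.hasSatakeParamAt_cofinite_holds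
    have h2 : ∀ᶠ v : HeightOneSpectrum (𝓞 K) in cofinite, ((ℓ : ℕ) : 𝓞 K) ∉ v.asIdeal := by
      have hne : Ideal.span {((ℓ : ℕ) : 𝓞 K)} ≠ ⊥ := by
        rw [Ne, Ideal.span_singleton_eq_bot]
        exact_mod_cast (Fact.out : ℓ.Prime).ne_zero
      refine Filter.mem_of_superset (Ideal.finite_factors hne).compl_mem_cofinite ?_
      intro v hv hmem
      exact hv (Ideal.dvd_span_singleton.2 hmem)
    filter_upwards [h1, h2] with v ⟨β, hβ⟩ hv
    obtain ⟨hurv, hch⟩ := hcomp v hv β hβ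
    refine ⟨_, AutomorphicRepData.HasSatakeParamAt.of_map_mulChar_detTwist_of_cpow hχ hW hW' hβ,
      hurv, ?_⟩
    rwa [arithFrobPolyOfSatake_one_map_cpow_half_two ι v.residueCard]
  -- local–global compatibility for `π₁` at `w`: `rec_w(π₁,w)` is the class of an unramified `r'`
  obtain ⟨llc, hllc⟩ := galoisRep_GL2_totallyReal_localGlobal.exists_llc_recGL_unramified hLG K hK
  obtain ⟨πv, r', hr', hloc, hN, hur', hq⟩ := hllc hcpt π₁ hL₁ hreg₁ ℓ ι r hirr hae w hw hur
  -- `π₁,w` is generic (a local component of a cuspidal Borel–Jacquet datum on `GL₂`)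
  obtain ⟨ψ, hψ, hgen⟩ := π₁.exists_isGeneric_of_hasLocalComponentAt w πv.ρ πv.isSmooth hloc
  -- (JL): `L(s, π₁,w × 1)` has degree `2`, so `π₁,w` is spherical
  haveI : CharZero (w.adicCompletion K) :=
    charZero_of_injective_algebraMap (algebraMap K (w.adicCompletion K)).injective
  obtain ⟨x, hx0, hxK⟩ := hJL (w.adicCompletion K) πv ψ hψ hgen
    (fun ν _ _ _ => hasRSLFactor_of_recGL_unramified (llc w) πv r' hr' hq hN hur' ψ hψ hgen ν)
  rw [glInt_adicCompletion_eq] at hxK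
  -- Borel–Jacquet dictionary; untwist
  have hπ₁ : π₁.1.IsUnramifiedAt w :=
    π₁.1.isUnramifiedAt_of_hasLocalComponentAt_of_mem_fixedPoints w πv hloc hx0 hxK
  exact (isUnramifiedAt_iff_of_twist hχ hW hW' w).mp hπ₁

include hJL in
/-- **`Langlands1980_quadraticBaseChange_frobCompatible` from local–global compatibility (the tree's
fact `galoisRep_GL2_totallyReal_localGlobal`, verbatim), the local theorem (JL) and the base-change
facts.**  Granted (JL) (module docstring), lang.S27 (`exists_galoisRep_of_regularAlgebraic`),
`ArthurClozel1989_strongLifting_archimedean`, `baseChange_cyclic_cuspidal` and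
`ArthurClozel1989_strongLifting_unramified`, the named fact of `QuadraticBaseChangeFrobCompatible`
follows from `galoisRep_GL2_totallyReal_localGlobal`: (C) is
`isUnramifiedAt_of_isGaloisCompatibleAt_of_localGlobal_of_lFactor`, and
`Langlands1980_quadraticBaseChange_frobCompatible_of_carayol` (`…AuxFieldProofs`) does the rest.
[cite: LanglandsBaseChange1980, §2 (A), (F), pp. 19–20] [cite: CarayolASENS1986, Thm. (A)]
[cite: ArthurClozelAMS120, Ch. 3 Thm. 4.2 and Thm. 5.1] [cite: HarrisTaylorAMS2001, Thm. A] -/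
theorem Langlands1980_quadraticBaseChange_frobCompatible_of_localGlobal_of_lFactor
    (hLG : galoisRep_GL2_totallyReal_localGlobal)
    (h27 : exists_galoisRep_of_regularAlgebraic) (hArch : ArthurClozel1989_strongLifting_archimedean)
    (hBCc : baseChange_cyclic_cuspidal) (hACu : ArthurClozel1989_strongLifting_unramified) :
    Langlands1980_quadraticBaseChange_frobCompatible :=
  Langlands1980_quadraticBaseChange_frobCompatible_of_carayol
    (fun hcpt hK π hreg ℓ _ ι r hirr hcomp w hw hur =>
      isUnramifiedAt_of_isGaloisCompatibleAt_of_localGlobal_of_lFactor hJL hLG hcpt hK π hreg ℓ ι r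
        hirr hcomp w hw hur)
    h27 hArch hBCc hACu

end LocalGlobal

end Literature.NumberTheory.Automorphic

end
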